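import Summits.CriticalPhenomena.PercolationContinuityZ3.Theorems.FK.PartitionFunctionPDerivative
import Summits.CriticalPhenomena.PercolationContinuityZ3.Theorems.FK.PressureUniquenessCriterion
import Summits.CriticalPhenomena.PercolationContinuityZ3.Theorems.FK.BoundaryWiringEdgeDensity
import HarnessLib

/-!
# FK-continuity cell, FO-10a: Grimmett 2006 (4.73)–(4.77) as printed — the `p`-derivatives of the finite-volume pressures
# CONVERGE: to the left derivative `Φ'(p−) = d(h⁰−p)/(p(1−p))` for free boundary conditions, to the right derivative
# `Φ'(p+) = d(h¹−p)/(p(1−p))` for wired ones, every one-class wiring lies between them, and they converge to `Φ'(p)` for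
# EVERY one-class boundary wiring at points of differentiability (`p ∉ 𝒟_q`)

Registered R110 (cell INBOX l.7501, 2026-08-25); registry row FO-10a-g341p; label PDV-B (coordinator fk-4 g227).
Cell `fk-continuity` (bschramm), row FO-10a (pressure layer); support file for the FK-continuity transplant
(`--supports stmt-CriticalPhenomena-4575`); builds on p205010 (kernel theorem, internal audit signed; external expert
review pending). Pure proofs; no definitions, no named facts, no sorries; `d ≥ 1` through a lattice edge `e₀`.
UNCONDITIONAL finite- and infinite-volume structure; it decides nothing about FH / TP_FK / the value of `p_c(q)`.

Grimmett's (4.74): "by the convexity of the `G^ξ_Λ`, `dG^ξ_Λ/dπ → dG/dπ` as `Λ ↑ ℤ^d`, `ξ ∈ Ω`, `p ∉ 𝒟_q`", with (4.73)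
`dG^ξ_Λ/dπ = |E_Λ|⁻¹ φ^ξ_{Λ,p,q}(|η ∩ E_Λ|)` and (4.76)–(4.77) `dG/dπ⁺ = φ¹_{p,q}(J_e)`, `dG/dπ⁻ = φ⁰_{p,q}(J_e)`. In the tree's per-site,
`p`-variable normalisation (`PressureUniquenessCriterion`: `Φ'(p+) = d(h¹(p,q)−p)/(p(1−p))`, `Φ'(p−) = d(h⁰(p,q)−p)/(p(1−p))`), with
`F^B_N(r) = |Λ_N|⁻¹ log Z^B_{Λ_N}(r,q)` and `∂_p F^B_N(p) = (|Λ_N|⁻¹E^B_{Λ_N,p,q}|ω| − p|E_{Λ_N}|/|Λ_N|)/(p(1−p))`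
(`PartitionFunctionPDerivative`), the mean edge densities of `PressureEdgeDensity` / `BoundaryWiringEdgeDensity` give, for
`0 < p < 1`, `q ≥ 1`:

* **`tendsto_deriv_boxPressure_p_false`** / **`…_true`** — `∂_p F⁰_N(p) → d(h⁰−p)/(p(1−p))`, `∂_p F¹_N(p) → d(h¹−p)/(p(1−p))`;
* `exists_tendsto_deriv_boxPressure_p_false_and_hasDerivWithinAt_Iio` / `…_true_…_Ioi` — under Thm. (4.58)'s convergence of the
  free per-site pressures to `Φ` on `(0,1)`: `lim_N ∂_p F⁰_N(p) = Φ'(p−)` and `lim_N ∂_p F¹_N(p) = Φ'(p+)` ((4.76)–(4.77) with (4.74));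
* `deriv_boxPressure_p_false_le_wiring` / `deriv_boxPressure_p_wiring_le_true` — the finite-`N` sandwich
  `∂_p F⁰_N(p) ≤ ∂_p F^B_N(p) ≤ ∂_p F¹_N(p)` for every wired class `B ⊆ ∂Λ_N` ((4.75));
* **`tendsto_deriv_boxPressure_p_wiring_of_edgeDensity_eq`** / `…_of_rcLimit_eq` — if `h⁰(p,q) = h¹(p,q)` (resp. `φ⁰ = φ¹`),
  `∂_p F^{B_N}_N(p) → d(h⁰−p)/(p(1−p))` along EVERY `B_N ⊆ ∂Λ_N`;
* **`tendsto_deriv_boxPressure_p_wiring_of_differentiableAt`** — (4.74) verbatim: if `Φ` is differentiable at `p` then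
  `∂_p F^{B_N}_N(p) → Φ'(p)` along every `B_N ⊆ ∂Λ_N`;
* `tendsto_deriv_boxPressure_p_wiring_rcCriticalProb_two` — the critical FK–Ising model, `d ≥ 3`: the `p`-derivatives of the
  finite-volume pressures at `p_c(2)` converge WHATEVER the wirings (ADS 2015 through `BoundaryWiringEdgeDensity`).

## References

* G. Grimmett, *The Random-Cluster Model*, Springer 2006 (`book:grimmett2006-random-cluster-model`): §4.5 Thm. (4.58),
  (4.70)–(4.77) [PDF pp. 92–93]; Conj. (5.34)(ii). [Grimmett2006]
* M. Aizenman, H. Duminil-Copin, V. Sidoravicius, Comm. Math. Phys. 334 (2015) 719–742, Thm. 1.2, Cor. 1.5(1).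
  [AizenmanDuminilCopinSidoraviciusCMP2015]
-/

noncomputable section

open scoped Classical
open Finset Filter Topology MeasureTheory

namespace Summit.CriticalPhenomena.PercolationContinuityZ3.Theorems.FK

open Literature.Probability.Percolation Literature.Probability.LatticeModels
open Literature.Barriers.CriticalPhenomena

variable {d : ℕ} {p q : ℝ} {e₀ : Sym2 (Site d)}

/-! ### Free and wired: the finite-volume `p`-derivatives converge to `d(h^b − p)/(p(1−p))` -/

section FreeWired

/-- The limit of `(u_N − p v_N)/(p(1−p))` from the limits of `u_N` and `v_N`. [folklore] -/
theorem tendsto_deriv_boxPressure_p_of_tendsto (hp : p ∈ Set.Ioo (0 : ℝ) 1) (hq : 0 < q)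
    (B : ∀ N : ℕ, Set ↥(box d N)) {L : ℝ}
    (hu : Tendsto (fun N : ℕ => rcExpect (finsetGraph (zdGraph d) (box d N)) p q (B N) (fun ω => (#ω : ℝ)) / #(box d N))
      atTop (𝓝 L)) :
    Tendsto (fun N : ℕ => deriv (fun r => Real.log (rcPartitionFunction (finsetGraph (zdGraph d) (box d N)) r q (B N)) /
        #(box d N)) p) atTop (𝓝 ((L - p * d) / (p * (1 - p)))) := by
  have h := (hu.sub ((tendsto_card_edgeFinset_box_div_card_box (d := d)).const_mul p)).div_const (p * (1 - p))
  refine h.congr fun N => ?_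
  rw [deriv_log_rcPartitionFunction_box_div_p hp hq (B N)]

/-- **`∂_p (|Λ_N|⁻¹ log Z⁰_{Λ_N}(p,q)) → d (h⁰(p,q) − p)/(p(1−p))`** for the FREE box measures (`0 < p < 1`, `q ≥ 1`, `e₀` a lattice
edge, `h⁰ = freeEdgeDensity d p q e₀`). [cite: Grimmett2006, (4.73)–(4.76)] -/
theorem tendsto_deriv_boxPressure_p_false (hp : p ∈ Set.Ioo (0 : ℝ) 1) (hq : 1 ≤ q) (he₀ : e₀ ∈ (zdGraph d).edgeSet) :
    Tendsto (fun N : ℕ => deriv (fun r => Real.log (rcPartitionFunction (finsetGraph (zdGraph d) (box d N)) r q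
        (boxBC d false N)) / #(box d N)) p) atTop (𝓝 (d * (freeEdgeDensity d p q e₀ - p) / (p * (1 - p)))) := by
  have h := tendsto_deriv_boxPressure_p_of_tendsto hp (one_pos.trans_le hq) (fun N => boxBC d false N)
    (tendsto_rcExpect_card_div_card_box_false ⟨hp.1.le, hp.2.le⟩ hq he₀)
  have e : (d * freeEdgeDensity d p q e₀ - p * d) / (p * (1 - p)) = d * (freeEdgeDensity d p q e₀ - p) / (p * (1 - p)) := by
    ring
  rwa [e] at h

/-- **`∂_p (|Λ_N|⁻¹ log Z¹_{Λ_N}(p,q)) → d (h¹(p,q) − p)/(p(1−p))`** for the WIRED box measures (`0 < p < 1`, `q ≥ 1`,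
`h¹ = wiredEdgeDensity d p q e₀`). [cite: Grimmett2006, (4.73)–(4.76)] -/
theorem tendsto_deriv_boxPressure_p_true (hp : p ∈ Set.Ioo (0 : ℝ) 1) (hq : 1 ≤ q) (he₀ : e₀ ∈ (zdGraph d).edgeSet) :
    Tendsto (fun N : ℕ => deriv (fun r => Real.log (rcPartitionFunction (finsetGraph (zdGraph d) (box d N)) r q
        (boxBC d true N)) / #(box d N)) p) atTop (𝓝 (d * (wiredEdgeDensity d p q e₀ - p) / (p * (1 - p)))) := by
  have h := tendsto_deriv_boxPressure_p_of_tendsto hp (one_pos.trans_le hq) (fun N => boxBC d true N)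
    (tendsto_rcExpect_card_div_card_box_true ⟨hp.1.le, hp.2.le⟩ hq he₀)
  have e : (d * wiredEdgeDensity d p q e₀ - p * d) / (p * (1 - p)) = d * (wiredEdgeDensity d p q e₀ - p) / (p * (1 - p)) := by
    ring
  rwa [e] at h

/-- **(4.76)–(4.77) with (4.74), free boundary condition: `lim_N ∂_p F⁰_N(p) = Φ'(p−)`** — the `p`-derivatives of the
finite-volume FREE pressures converge to the LEFT derivative of the pressure (hypothesis: the free per-site pressures converge
to `Φ` on `(0,1)`, Thm. (4.58)). [cite: Grimmett2006, (4.74), (4.76)–(4.77)] -/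
theorem exists_tendsto_deriv_boxPressure_p_false_and_hasDerivWithinAt_Iio (hp : p ∈ Set.Ioo (0 : ℝ) 1) (hq : 1 ≤ q)
    (he₀ : e₀ ∈ (zdGraph d).edgeSet) {Φ : ℝ → ℝ}
    (hΦ : ∀ x ∈ Set.Ioo (0 : ℝ) 1, Tendsto (fun N : ℕ =>
      Real.log (rcPartitionFunction (finsetGraph (zdGraph d) (box d N)) x q (boxBC d false N)) / #(box d N)) atTop (𝓝 (Φ x))) :
    ∃ D : ℝ, Tendsto (fun N : ℕ => deriv (fun r => Real.log (rcPartitionFunction (finsetGraph (zdGraph d) (box d N)) r q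
        (boxBC d false N)) / #(box d N)) p) atTop (𝓝 D) ∧ HasDerivWithinAt Φ D (Set.Iio p) p :=
  ⟨_, tendsto_deriv_boxPressure_p_false hp hq he₀, hasDerivWithinAt_pressure_Iio' hp hq he₀ hΦ⟩

/-- **(4.76)–(4.77) with (4.74), wired boundary condition: `lim_N ∂_p F¹_N(p) = Φ'(p+)`** — the `p`-derivatives of the
finite-volume WIRED pressures converge to the RIGHT derivative of the pressure. [cite: Grimmett2006, (4.74), (4.76)–(4.77)] -/
theorem exists_tendsto_deriv_boxPressure_p_true_and_hasDerivWithinAt_Ioi (hp : p ∈ Set.Ioo (0 : ℝ) 1) (hq : 1 ≤ q)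
    (he₀ : e₀ ∈ (zdGraph d).edgeSet) {Φ : ℝ → ℝ}
    (hΦ : ∀ x ∈ Set.Ioo (0 : ℝ) 1, Tendsto (fun N : ℕ =>
      Real.log (rcPartitionFunction (finsetGraph (zdGraph d) (box d N)) x q (boxBC d false N)) / #(box d N)) atTop (𝓝 (Φ x))) :
    ∃ D : ℝ, Tendsto (fun N : ℕ => deriv (fun r => Real.log (rcPartitionFunction (finsetGraph (zdGraph d) (box d N)) r q
        (boxBC d true N)) / #(box d N)) p) atTop (𝓝 D) ∧ HasDerivWithinAt Φ D (Set.Ioi p) p :=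
  ⟨_, tendsto_deriv_boxPressure_p_true hp hq he₀, hasDerivWithinAt_pressure_Ioi' hp hq he₀ hΦ⟩

end FreeWired

/-! ### Arbitrary one-class boundary wirings `B_N ⊆ ∂Λ_N` -/

section Wiring

/-- **(4.75), lower half of the finite-`N` sandwich: `∂_p F⁰_N(p) ≤ ∂_p F^B_N(p)`** for every wired class `B` of `Λ_N`
(`0 < p < 1`, `q ≥ 1`; `E⁰_{Λ_N}|ω| ≤ E^B_{Λ_N}|ω|` by `φ⁰_{Λ_N} ≤ φ^B_{Λ_N}` on the events `J_e`). [cite: Grimmett2006, (4.75)] -/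
theorem deriv_boxPressure_p_false_le_wiring (hp : p ∈ Set.Ioo (0 : ℝ) 1) (hq : 1 ≤ q) {N : ℕ} (B : Set ↥(box d N)) :
    deriv (fun r => Real.log (rcPartitionFunction (finsetGraph (zdGraph d) (box d N)) r q (boxBC d false N)) / #(box d N)) p ≤
      deriv (fun r => Real.log (rcPartitionFunction (finsetGraph (zdGraph d) (box d N)) r q B) / #(box d N)) p := by
  have hq0 : 0 < q := one_pos.trans_le hq
  have hp' : p ∈ Set.Icc (0 : ℝ) 1 := ⟨hp.1.le, hp.2.le⟩
  have hpp : 0 < p * (1 - p) := mul_pos hp.1 (sub_pos.2 hp.2)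
  rw [deriv_log_rcPartitionFunction_box_div_p hp hq0, deriv_log_rcPartitionFunction_box_div_p hp hq0]
  refine div_le_div_of_nonneg_right (sub_le_sub_right ?_ _) hpp.le
  rw [rcExpect_card_div_card_box_eq hp' hq0, rcExpect_card_div_card_box_eq hp' hq0]
  refine div_le_div_of_nonneg_right ?_ (Nat.cast_nonneg _)
  have h := sum_boxFreeEdgeProb_le_sum_rcMeasure_real_eOpen hp' hq B (d := d) (N := N)
  refine le_trans (le_of_eq ?_) h
  refine Finset.sum_congr rfl fun e _ => ?_
  rfl

/-- **(4.75), upper half of the finite-`N` sandwich: `∂_p F^B_N(p) ≤ ∂_p F¹_N(p)`** for every wired class `B ⊆ ∂Λ_N`.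
[cite: Grimmett2006, (4.75)] -/
theorem deriv_boxPressure_p_wiring_le_true (hp : p ∈ Set.Ioo (0 : ℝ) 1) (hq : 1 ≤ q) {N : ℕ} {B : Set ↥(box d N)}
    (hB : B ⊆ boxBC d true N) :
    deriv (fun r => Real.log (rcPartitionFunction (finsetGraph (zdGraph d) (box d N)) r q B) / #(box d N)) p ≤
      deriv (fun r => Real.log (rcPartitionFunction (finsetGraph (zdGraph d) (box d N)) r q (boxBC d true N)) / #(box d N)) p := by
  have hq0 : 0 < q := one_pos.trans_le hq
  have hp' : p ∈ Set.Icc (0 : ℝ) 1 := ⟨hp.1.le, hp.2.le⟩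
  have hpp : 0 < p * (1 - p) := mul_pos hp.1 (sub_pos.2 hp.2)
  rw [deriv_log_rcPartitionFunction_box_div_p hp hq0, deriv_log_rcPartitionFunction_box_div_p hp hq0]
  refine div_le_div_of_nonneg_right (sub_le_sub_right ?_ _) hpp.le
  rw [rcExpect_card_div_card_box_eq hp' hq0, rcExpect_card_div_card_box_eq hp' hq0]
  refine div_le_div_of_nonneg_right ?_ (Nat.cast_nonneg _)
  have h := sum_rcMeasure_real_eOpen_le_sum_boxWiredEdgeProb hp' hq hB (d := d)
  refine le_trans h (le_of_eq ?_)
  refine Finset.sum_congr rfl fun e _ => ?_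
  rfl

/-- **If `h⁰(p,q) = h¹(p,q)` (`p ∉ 𝒟_q`): `∂_p F^{B_N}_N(p) → d(h⁰(p,q) − p)/(p(1−p))` along EVERY sequence of wired classes
`B_N ⊆ ∂Λ_N`** (`0 < p < 1`, `q ≥ 1`). [cite: Grimmett2006, (4.74)–(4.76)] -/
theorem tendsto_deriv_boxPressure_p_wiring_of_edgeDensity_eq (hp : p ∈ Set.Ioo (0 : ℝ) 1) (hq : 1 ≤ q)
    (he₀ : e₀ ∈ (zdGraph d).edgeSet) {B : ∀ N : ℕ, Set ↥(box d N)} (hB : ∀ N, B N ⊆ boxBC d true N)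
    (h : freeEdgeDensity d p q e₀ = wiredEdgeDensity d p q e₀) :
    Tendsto (fun N : ℕ => deriv (fun r => Real.log (rcPartitionFunction (finsetGraph (zdGraph d) (box d N)) r q (B N)) /
        #(box d N)) p) atTop (𝓝 (d * (freeEdgeDensity d p q e₀ - p) / (p * (1 - p)))) := by
  have h1 := tendsto_deriv_boxPressure_p_of_tendsto hp (one_pos.trans_le hq) B
    (tendsto_rcExpect_card_div_card_box_of_edgeDensity_eq ⟨hp.1.le, hp.2.le⟩ hq he₀ hB h)
  have e : (d * freeEdgeDensity d p q e₀ - p * d) / (p * (1 - p)) = d * (freeEdgeDensity d p q e₀ - p) / (p * (1 - p)) := by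
    ring
  rwa [e] at h1

/-- **Under uniqueness `φ⁰_{p,q} = φ¹_{p,q}`: `∂_p F^{B_N}_N(p) → d(h⁰(p,q) − p)/(p(1−p))` along every `B_N ⊆ ∂Λ_N`.**
[cite: Grimmett2006, Thm. (4.63) with (4.74)–(4.76)] -/
theorem tendsto_deriv_boxPressure_p_wiring_of_rcLimit_eq (hp : p ∈ Set.Ioo (0 : ℝ) 1) (hq : 1 ≤ q)
    (he₀ : e₀ ∈ (zdGraph d).edgeSet) {B : ∀ N : ℕ, Set ↥(box d N)} (hB : ∀ N, B N ⊆ boxBC d true N)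
    (huniq : rcLimit d false p q = rcLimit d true p q) :
    Tendsto (fun N : ℕ => deriv (fun r => Real.log (rcPartitionFunction (finsetGraph (zdGraph d) (box d N)) r q (B N)) /
        #(box d N)) p) atTop (𝓝 (d * (freeEdgeDensity d p q e₀ - p) / (p * (1 - p)))) :=
  tendsto_deriv_boxPressure_p_wiring_of_edgeDensity_eq hp hq he₀ hB
    (edgeDensity_eq_of_rcLimit_false_eq_rcLimit_true ⟨hp.1.le, hp.2.le⟩ hq huniq he₀)

/-- **Grimmett's (4.74) for every one-class boundary wiring: if the pressure `Φ` is differentiable at `p` then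
`∂_p F^{B_N}_N(p) → Φ'(p)` along EVERY sequence of wired classes `B_N ⊆ ∂Λ_N`** (`0 < p < 1`, `q ≥ 1`; hypothesis: the free
per-site pressures converge to `Φ` on `(0,1)`, Thm. (4.58); differentiability forces `h⁰ = h¹`, Thm. (4.63)).
[cite: Grimmett2006, (4.74) with Thm. (4.63) and (4.76)–(4.77)] -/
theorem tendsto_deriv_boxPressure_p_wiring_of_differentiableAt (hp : p ∈ Set.Ioo (0 : ℝ) 1) (hq : 1 ≤ q)
    (he₀ : e₀ ∈ (zdGraph d).edgeSet) {Φ : ℝ → ℝ}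
    (hΦ : ∀ x ∈ Set.Ioo (0 : ℝ) 1, Tendsto (fun N : ℕ =>
      Real.log (rcPartitionFunction (finsetGraph (zdGraph d) (box d N)) x q (boxBC d false N)) / #(box d N)) atTop (𝓝 (Φ x)))
    (hdiff : DifferentiableAt ℝ Φ p) {B : ∀ N : ℕ, Set ↥(box d N)} (hB : ∀ N, B N ⊆ boxBC d true N) :
    Tendsto (fun N : ℕ => deriv (fun r => Real.log (rcPartitionFunction (finsetGraph (zdGraph d) (box d N)) r q (B N)) /
        #(box d N)) p) atTop (𝓝 (deriv Φ p)) := by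
  have hh : freeEdgeDensity d p q e₀ = wiredEdgeDensity d p q e₀ :=
    (differentiableAt_pressure_iff_edgeDensity_eq' hp hq he₀ hΦ).1 hdiff
  have hD : deriv Φ p = d * (freeEdgeDensity d p q e₀ - p) / (p * (1 - p)) :=
    (uniqueDiffWithinAt_Iio p).eq_deriv _ hdiff.hasDerivAt.hasDerivWithinAt
      (hasDerivWithinAt_pressure_Iio' hp hq he₀ hΦ)
  rw [hD]
  exact tendsto_deriv_boxPressure_p_wiring_of_edgeDensity_eq hp hq he₀ hB hh

/-- **The critical FK–Ising model on `ℤ^d`, `d ≥ 3`: the `p`-derivatives at `p_c(2)` of the finite-volume pressures converge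
WHATEVER the boundary wirings `B_N ⊆ ∂Λ_N`** (no latent heat at `β_c`: `h⁰(p_c(2),2) = h¹(p_c(2),2)`, ADS 2015 via
`BoundaryWiringEdgeDensity`). [cite: Grimmett2006, (4.74) with Thm. (4.63); Conj. (5.34)(ii) at q = 2]
[cite: AizenmanDuminilCopinSidoraviciusCMP2015, Thm. 1.2 with Cor. 1.5 (1)] -/
theorem tendsto_deriv_boxPressure_p_wiring_rcCriticalProb_two (hd : 3 ≤ d) (he₀ : e₀ ∈ (zdGraph d).edgeSet)
    {B : ∀ N : ℕ, Set ↥(box d N)} (hB : ∀ N, B N ⊆ boxBC d true N) :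
    Tendsto (fun N : ℕ => deriv (fun r => Real.log (rcPartitionFunction (finsetGraph (zdGraph d) (box d N)) r 2 (B N)) /
        #(box d N)) (rcCriticalProb d 2)) atTop
      (𝓝 (d * (freeEdgeDensity d (rcCriticalProb d 2) 2 e₀ - rcCriticalProb d 2) /
        (rcCriticalProb d 2 * (1 - rcCriticalProb d 2)))) := by
  have hp := rcCriticalProb_mem_Ioo (show 2 ≤ d by omega) (show (1 : ℝ) ≤ 2 by norm_num)
  have h1 := tendsto_deriv_boxPressure_p_of_tendsto hp (by norm_num) B
    (tendsto_rcExpect_card_div_card_box_rcCriticalProb_two hd he₀ hB)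
  have e : (d * freeEdgeDensity d (rcCriticalProb d 2) 2 e₀ - rcCriticalProb d 2 * d) /
      (rcCriticalProb d 2 * (1 - rcCriticalProb d 2)) =
      d * (freeEdgeDensity d (rcCriticalProb d 2) 2 e₀ - rcCriticalProb d 2) / (rcCriticalProb d 2 * (1 - rcCriticalProb d 2)) := by
    ring
  rwa [e] at h1

end Wiring

end Summit.CriticalPhenomena.PercolationContinuityZ3.Theorems.FK

end
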